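import Summits.CriticalPhenomena.PercolationContinuityZ3.Theorems.PercNearOneGluingNoHeavyLowerTailAPLGluedClusters
import HarnessLib

/-!
# `NoHeavyLowerTail` (stmt-CriticalPhenomena-4575) — SERIES GLUING AT A CUT VERTEX, I: the join formulas for two pieces glued at `{o, c}`

Support file (prover prim-ineq-gen-8 gen 58; `--supports stmt-CriticalPhenomena-4575`; memo
run/shared/lean/prim/prim-ineq-gen-8/FINDING-gen58-SERIES-LEAN.md §1).  Pure combinatorics: no definitions, no named facts, no sorries.

SETTING (the series decomposition of the `E`-route, memo gen 57 §0(8), in the two-piece form of gen 58).  Finite configurations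
`S₁ S₂ : Finset (Sym2 V)` (open edges of the two pieces), an apex `o`, a cut vertex `c`, and ports `u` (on the side of `S₁`) and
`v` (on the side of `S₂`).  GLUING HYPOTHESES: every vertex meeting an edge of `S₁` and an edge of `S₂` is `o` or `c` (the two
pieces of `G ∖ o` meet only in the cut vertex `c`; both may contain apex edges); `u` meets no edge of `S₂` unless `u = c`, and `v`
meets no edge of `S₁` unless `v = c` (degenerate ports `u = c` / `v = c` are allowed: they give the "apex edge pendant at a port"
step); `u, v ≠ o`.  Clusters are `Literature.Probability.Percolation.Gladkov.cl`.
* `series_private` — a vertex that meets edges of `S` only if it equals `c`, and whose `S`-cluster is not a singleton, is `c`.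
* `series_oc_iff` — `c ∈ cl (S₁ ∪ S₂) o ↔ c ∈ cl S₁ o ∨ c ∈ cl S₂ o`.
* **`series_ou_iff`** — `u ∈ cl (S₁ ∪ S₂) o ↔ u ∈ cl S₁ o ∨ (c ∈ cl S₁ u ∧ (c ∈ cl S₁ o ∨ c ∈ cl S₂ o))`: the apex reaches `u`
  inside piece 1, or `u` reaches the cut vertex inside piece 1 and the apex reaches the cut vertex in either piece.
* **`series_ov_iff`** — the mirror statement for `v`.
* **`series_m_iff`** — `(u ∉ cl (S₁ ∪ S₂) o ∧ v ∈ cl (S₁ ∪ S₂) u) ↔ (u ∉ cl S₁ o ∧ c ∈ cl S₁ u) ∧ (v ∉ cl S₂ o ∧ c ∈ cl S₂ v)`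
  (`u ≠ v`): the ports are joined avoiding the apex iff each port is joined to the cut vertex avoiding the apex in its own piece
  — the event form of `m = m₁·m₂`.
All four are instances of the three-terminal join formulas `glued_ab_iff` / `glued_cl_core` of `…APLGluedClusters.lean`
(terminals `(u; o, c)`), plus the bookkeeping of the private ports. [folklore]
-/

namespace Summit.CriticalPhenomena.PercolationContinuityZ3.Theorems

namespace APL

open Literature.Probability.Percolation Literature.Probability.Percolation.Gladkov
open scoped Classical

variable {V : Type*} [Fintype V] [DecidableEq V]

omit [DecidableEq V] in
/-- A vertex `x` meeting edges of `S` only if `x = c`, whose cluster contains another vertex, is `c`. [folklore] -/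
theorem series_private {S : Finset (Sym2 V)} {x c y : V} (hx : ∀ e ∈ S, x ∈ e → x = c)
    (hy : y ∈ cl S x) (hne : y ≠ x) : x = c := by
  obtain ⟨e, he, hxe⟩ := exists_mem_edge_of_mem_cl (mem_cl_comm.1 hy) hne.symm
  exact hx e he hxe

/-- **Join formula `o ~ c`** for two pieces glued at `{o, c}`: `c ∈ cl (S₁ ∪ S₂) o ↔ c ∈ cl S₁ o ∨ c ∈ cl S₂ o`. [folklore] -/
theorem series_oc_iff (S₁ S₂ : Finset (Sym2 V)) (o c : V)
    (hsep : ∀ x : V, (∃ e ∈ S₁, x ∈ e) → (∃ e ∈ S₂, x ∈ e) → (x = o ∨ x = c)) :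
    c ∈ cl (S₁ ∪ S₂) o ↔ (c ∈ cl S₁ o ∨ c ∈ cl S₂ o) := by
  have h := glued_ab_iff S₁ S₂ o c c
    (fun x h1 h2 => (hsep x h1 h2).elim Or.inl fun h => Or.inr (Or.inl h))
  rw [h]
  constructor
  · rintro (h1 | ⟨h2, _⟩)
    · exact h1
    · exact h2
  · exact fun h1 => Or.inl h1

/-- **Join formula `o ~ u`** for two pieces glued at `{o, c}` with `u` private to piece 1 (or `u = c`):
`u ∈ cl (S₁ ∪ S₂) o ↔ u ∈ cl S₁ o ∨ (c ∈ cl S₁ u ∧ (c ∈ cl S₁ o ∨ c ∈ cl S₂ o))`. [folklore] -/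
theorem series_ou_iff (S₁ S₂ : Finset (Sym2 V)) (o c u : V)
    (hsep : ∀ x : V, (∃ e ∈ S₁, x ∈ e) → (∃ e ∈ S₂, x ∈ e) → (x = o ∨ x = c))
    (hu : ∀ e ∈ S₂, u ∈ e → u = c) (huo : u ≠ o) :
    u ∈ cl (S₁ ∪ S₂) o ↔ (u ∈ cl S₁ o ∨ (c ∈ cl S₁ u ∧ (c ∈ cl S₁ o ∨ c ∈ cl S₂ o))) := by
  have hsep' : ∀ x : V, (∃ e ∈ S₁, x ∈ e) → (∃ e ∈ S₂, x ∈ e) → (x = u ∨ x = o ∨ x = c) :=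
    fun x h1 h2 => Or.inr (hsep x h1 h2)
  have h := glued_ab_iff S₁ S₂ u o c hsep'
  -- `h : o ∈ cl (S₁ ∪ S₂) u ↔ (o ∈ cl S₁ u ∨ o ∈ cl S₂ u) ∨ ((c ∈ cl S₁ u ∨ c ∈ cl S₂ u) ∧ (o ∈ cl S₁ c ∨ o ∈ cl S₂ c))`
  rw [mem_cl_comm, h, mem_cl_comm (K := S₁) (x := u) (v := o), mem_cl_comm (K := S₁) (x := c) (v := o),
    mem_cl_comm (K := S₂) (x := c) (v := o)]
  rcases eq_or_ne u c with rfl | huc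
  · -- degenerate port `u = c`
    have h1 : u ∈ cl S₁ u := mem_cl_self _ _
    have h2 : u ∈ cl S₂ u := mem_cl_self _ _
    constructor
    · rintro ((a | a) | ⟨_, b⟩)
      · exact Or.inl a
      · exact Or.inr ⟨h1, Or.inr (mem_cl_comm.1 a)⟩
      · exact Or.inr ⟨h1, b⟩
    · rintro (a | ⟨_, b⟩)
      · exact Or.inl (Or.inl a)
      · exact Or.inr ⟨Or.inl h1, b⟩
  · -- private port: `u` meets no edge of `S₂`
    have n1 : o ∉ cl S₂ u := fun h' => huc (series_private hu h' huo.symm)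
    have n2 : c ∉ cl S₂ u := fun h' => huc (series_private hu h' (Ne.symm huc))
    constructor
    · rintro ((a | a) | ⟨b, d⟩)
      · exact Or.inl a
      · exact absurd a n1
      · rcases b with b | b
        · exact Or.inr ⟨b, d⟩
        · exact absurd b n2
    · rintro (a | ⟨b, d⟩)
      · exact Or.inl (Or.inl a)
      · exact Or.inr ⟨Or.inl b, d⟩

/-- **Join formula `o ~ v`** (mirror of `series_ou_iff`): for `v` private to piece 2 (or `v = c`),
`v ∈ cl (S₁ ∪ S₂) o ↔ v ∈ cl S₂ o ∨ (c ∈ cl S₂ v ∧ (c ∈ cl S₂ o ∨ c ∈ cl S₁ o))`. [folklore] -/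
theorem series_ov_iff (S₁ S₂ : Finset (Sym2 V)) (o c v : V)
    (hsep : ∀ x : V, (∃ e ∈ S₁, x ∈ e) → (∃ e ∈ S₂, x ∈ e) → (x = o ∨ x = c))
    (hv : ∀ e ∈ S₁, v ∈ e → v = c) (hvo : v ≠ o) :
    v ∈ cl (S₁ ∪ S₂) o ↔ (v ∈ cl S₂ o ∨ (c ∈ cl S₂ v ∧ (c ∈ cl S₂ o ∨ c ∈ cl S₁ o))) := by
  rw [Finset.union_comm]
  exact series_ou_iff S₂ S₁ o c v (fun x h1 h2 => hsep x h2 h1) hv hvo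

/-- **The ports are joined avoiding the apex iff each port is joined to the cut vertex avoiding the apex in its own piece**
(event form of `m = m₁ m₂`): for `u ≠ v` (no hypothesis `v ≠ o` is needed),
`(u ∉ cl (S₁ ∪ S₂) o ∧ v ∈ cl (S₁ ∪ S₂) u) ↔ (u ∉ cl S₁ o ∧ c ∈ cl S₁ u) ∧ (v ∉ cl S₂ o ∧ c ∈ cl S₂ v)`. [folklore] -/
theorem series_m_iff (S₁ S₂ : Finset (Sym2 V)) (o c u v : V)
    (hsep : ∀ x : V, (∃ e ∈ S₁, x ∈ e) → (∃ e ∈ S₂, x ∈ e) → (x = o ∨ x = c))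
    (hu : ∀ e ∈ S₂, u ∈ e → u = c) (hv : ∀ e ∈ S₁, v ∈ e → v = c) (huo : u ≠ o) (huv : u ≠ v) :
    (u ∉ cl (S₁ ∪ S₂) o ∧ v ∈ cl (S₁ ∪ S₂) u) ↔ ((u ∉ cl S₁ o ∧ c ∈ cl S₁ u) ∧ (v ∉ cl S₂ o ∧ c ∈ cl S₂ v)) := by
  have hsep' : ∀ x : V, (∃ e ∈ S₁, x ∈ e) → (∃ e ∈ S₂, x ∈ e) → (x = u ∨ x = o ∨ x = c) :=
    fun x h1 h2 => Or.inr (hsep x h1 h2)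
  have hou := series_ou_iff S₁ S₂ o c u hsep hu huo
  have h1u : ∀ x, cl S₁ x ⊆ cl (S₁ ∪ S₂) x := fun x => ThreePointLB.cl_mono Finset.subset_union_left x
  have h2u : ∀ x, cl S₂ x ⊆ cl (S₁ ∪ S₂) x := fun x => ThreePointLB.cl_mono Finset.subset_union_right x
  constructor
  · rintro ⟨hno, hvu⟩
    -- the easy negative atoms
    have nuo : u ∉ cl S₁ o := fun h' => hno (h1u o h')
    have nvo : v ∉ cl S₂ o := fun h' =>
      hno (ThreePointLB.mem_cl_trans (h2u o h') (mem_cl_comm.1 hvu))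
    -- `o` is not joined to `u` in the glued configuration, as a statement about the closure formula
    have nΦ : ¬ ((o ∈ cl S₁ u ∨ o ∈ cl S₂ u) ∨ ((c ∈ cl S₁ u ∨ c ∈ cl S₂ u) ∧ (o ∈ cl S₁ c ∨ o ∈ cl S₂ c))) :=
      fun hΦ => hno (mem_cl_comm.1 ((glued_ab_iff S₁ S₂ u o c hsep').2 hΦ))
    -- where does `v` sit?  (`glued_cl_core` with terminals `(u; o, c)`)
    obtain ⟨t, hJ, hvt⟩ := glued_cl_core S₁ S₂ u o c hsep' hvu
    rcases hJ with ht | ⟨ht, hΦ⟩ | ⟨ht, hΦ⟩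
    · -- `t = u`
      rw [ht] at hvt
      rcases hvt with hv1 | hv2
      · -- `v ∈ cl S₁ u`: `v` meets an `S₁`-edge, so `v = c`
        have hvc : v = c := series_private hv (mem_cl_comm.1 hv1) huv
        refine ⟨⟨nuo, ?_⟩, ⟨nvo, ?_⟩⟩
        · rw [← hvc]; exact hv1
        · rw [hvc]; exact mem_cl_self _ _
      · -- `v ∈ cl S₂ u`: `u` meets an `S₂`-edge, so `u = c`
        have huc : u = c := series_private hu hv2 huv.symm
        refine ⟨⟨nuo, ?_⟩, ⟨nvo, ?_⟩⟩
        · rw [huc]; exact mem_cl_self _ _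
        · rw [← huc]; exact mem_cl_comm.1 hv2
    · exact absurd hΦ nΦ
    · -- `t = c`
      rw [ht] at hvt
      have huc : c ∈ cl S₁ u := by
        rcases hΦ with (a | a) | ⟨b, _⟩
        · exact a
        · rcases eq_or_ne u c with h0 | hne
          · rw [h0]; exact mem_cl_self _ _
          · exact absurd (series_private hu a hne.symm) hne
        · exact absurd (Or.inl b) nΦ
      refine ⟨⟨nuo, huc⟩, ⟨nvo, ?_⟩⟩
      rcases hvt with hv1 | hv2
      · rcases eq_or_ne v c with h0 | hne
        · rw [h0]; exact mem_cl_self _ _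
        · exact absurd (series_private hv (mem_cl_comm.1 hv1) hne.symm) hne
      · exact mem_cl_comm.1 hv2
  · rintro ⟨⟨nuo, huc⟩, ⟨nvo, hvc⟩⟩
    refine ⟨fun h' => ?_, ?_⟩
    · rcases hou.1 h' with a | ⟨_, b | b⟩
      · exact nuo a
      · -- `c ∈ cl S₁ o` and `c ∈ cl S₁ u` give `u ∈ cl S₁ o`
        exact nuo (ThreePointLB.mem_cl_trans b (mem_cl_comm.1 huc))
      · exact nvo (ThreePointLB.mem_cl_trans b (mem_cl_comm.1 hvc))
    · exact ThreePointLB.mem_cl_trans (h1u u huc) (mem_cl_comm.1 (h2u v hvc))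

end APL

end Summit.CriticalPhenomena.PercolationContinuityZ3.Theorems
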